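import Literature.MathematicalPhysics.QuantumManyBody.BoseGasFreeDirichletBEC
import Mathlib.Analysis.Convex.Integral

/-!
# Negative lemmas for crux `PeriodicToDirichlet` (stmt-AtomisticToContinuum-9483), rewarded free gas I:
a Dirichlet function cannot be flat up to the wall for free

Supports (does not close) stmt-AtomisticToContinuum-9483 (crux `PeriodicToDirichlet`, route
`BECThomsonPrinciple`), line `reward-pays-the-wall`, stub `Unrewarding` (skeleton
`Cruxes/PeriodicToDirichlet/Lines/reward-pays-the-wall.lean`, not an importable module: its
reward vocabulary is copied verbatim in part II). Filed by the crux disprover (gen 3). Series: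
I `RewardedFreeGasSlab` (translation/slab/one-body flat overlap) and III `RewardedFreeGasPlateau`
(plateau modes) are independent; II `RewardedFreeGasCap` (flat mode, `N`-body bound, the cap
`flatCap < 1` at `λ = 0`, reward vocabulary) imports I; IV `RewardedFreeGasAnchors` (rewarded
anchors for every `c < 1` at `v = 0`; `¬ UnrewardingSameConstant`) imports II and III.

This part (all `[folklore]`, sorry-free, no definitions):
* `lintegral_translate_sub_sq_le` — `∫ ‖u(x+h) − u(x)‖² ≤ ∫ ‖Du(x)h‖²` for `C¹` `u : ℝ³ → ℂ`
  (FTC along the segment, Jensen, Tonelli, translation invariance of Lebesgue measure);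
* `slab_sq_le` — a function vanishing off `Λ_L` pays for mass near a face:
  `∫_{x₁<s} ‖u‖² ≤ s² ∫ ‖∂₁u‖²`;
* `flatOverlap_sq_le` — ONE BODY: `L⁻³|∫_Λ u|² ≤ (2L/(2L+s)) (‖u‖² + s²‖∂₁u‖²)` for `C¹` `u`
  vanishing off `Λ_L`, `0 < s ≤ L` (mean/variance on the box + the slab inequality); the left side
  is `|⟨φ_L, u⟩|²` for the flat mode `φ_L = L^{-3/2}1_Λ`.
-/

noncomputable section

open MeasureTheory Filter Set Metric
open scoped ENNReal NNReal ComplexConjugate Topology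

namespace Summit.AtomisticToContinuum.BoseEinsteinCondensation.Theorems.PeriodicToDirichlet.Negative

open Literature.MathematicalPhysics.QuantumManyBody.BoseGas

/-! ## §1 Translation estimate and the slab inequality -/

/-- The line slice `t ↦ u(x + t•h)` has derivative `Du(x + t•h) h`. [folklore] -/
theorem hasDerivAt_lineSlice {u : Space → ℂ} (hu : Differentiable ℝ u) (x h : Space) (t : ℝ) :
    HasDerivAt (fun t : ℝ => u (x + t • h)) (fderiv ℝ u (x + t • h) h) t := by
  have h1 : HasDerivAt (fun t : ℝ => x + t • h) h t := by
    simpa using ((hasDerivAt_id t).smul_const h).const_add x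
  exact (hu (x + t • h)).hasFDerivAt.comp_hasDerivAt t h1

/-- The directional derivative along the segment is continuous in the parameter. [folklore] -/
theorem continuous_lineDeriv {u : Space → ℂ} (hu : ContDiff ℝ 1 u) (x h : Space) :
    Continuous fun t : ℝ => fderiv ℝ u (x + t • h) h :=
  ((hu.continuous_fderiv one_ne_zero).comp
    (continuous_const.add (continuous_id.smul continuous_const))).clm_apply continuous_const

/-- **FTC along a segment**: `u(x + h) − u(x) = ∫₀¹ Du(x + t•h) h dt` for `C¹` `u`. [folklore] -/
theorem sub_eq_integral_lineDeriv {u : Space → ℂ} (hu : ContDiff ℝ 1 u) (x h : Space) :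
    u (x + h) - u x = ∫ t in (0:ℝ)..1, fderiv ℝ u (x + t • h) h := by
  have hd : Differentiable ℝ u := hu.differentiable one_ne_zero
  rw [intervalIntegral.integral_eq_sub_of_hasDerivAt (fun t _ => hasDerivAt_lineSlice hd x h t)
    ((continuous_lineDeriv hu x h).intervalIntegrable 0 1)]
  simp

/-- **Jensen on `[0,1]`**: `‖∫₀¹ f‖² ≤ ∫₀¹ ‖f‖²` for continuous `f`. [folklore] -/
theorem norm_sq_intervalIntegral_le {f : ℝ → ℂ} (hf : Continuous f) :
    ‖∫ t in (0:ℝ)..1, f t‖ ^ 2 ≤ ∫ t in (0:ℝ)..1, ‖f t‖ ^ 2 := by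
  rw [intervalIntegral.integral_of_le zero_le_one, intervalIntegral.integral_of_le zero_le_one]
  haveI : IsProbabilityMeasure ((volume : Measure ℝ).restrict (Ioc (0:ℝ) 1)) :=
    ⟨by rw [Measure.restrict_apply_univ, Real.volume_Ioc]; simp⟩
  have hi1 : Integrable (fun t => ‖f t‖) ((volume : Measure ℝ).restrict (Ioc (0:ℝ) 1)) :=
    (hf.norm.integrableOn_Icc (a := 0) (b := 1)).mono_set Ioc_subset_Icc_self
  have hi2 : Integrable ((fun r : ℝ => r ^ 2) ∘ fun t => ‖f t‖)
      ((volume : Measure ℝ).restrict (Ioc (0:ℝ) 1)) :=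
    ((hf.norm.pow 2).integrableOn_Icc (a := 0) (b := 1)).mono_set Ioc_subset_Icc_self
  calc ‖∫ t in Ioc (0:ℝ) 1, f t‖ ^ 2 ≤ (∫ t in Ioc (0:ℝ) 1, ‖f t‖) ^ 2 := by
        gcongr
        exact norm_integral_le_integral_norm _
    _ ≤ ∫ t in Ioc (0:ℝ) 1, ‖f t‖ ^ 2 :=
        (Even.convexOn_pow even_two).map_integral_le (continuousOn_pow 2) isClosed_univ
          (ae_of_all _ fun _ => mem_univ _) hi1 hi2

/-- **Translation estimate**: `∫ ‖u(x + h) − u(x)‖² dx ≤ ∫ ‖Du(x) h‖² dx` for `C¹` `u : ℝ³ → ℂ`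
(both sides in `[0, ∞]`). [folklore] -/
theorem lintegral_translate_sub_sq_le {u : Space → ℂ} (hu : ContDiff ℝ 1 u) (h : Space) :
    ∫⁻ x, (‖u (x + h) - u x‖₊ : ℝ≥0∞) ^ 2 ≤ ∫⁻ x, (‖fderiv ℝ u x h‖₊ : ℝ≥0∞) ^ 2 := by
  set F : Space → ℝ → ℝ≥0∞ := fun x t => (‖fderiv ℝ u (x + t • h) h‖₊ : ℝ≥0∞) ^ 2 with hF
  -- pointwise: Jensen along the segment
  have hpt : ∀ x, (‖u (x + h) - u x‖₊ : ℝ≥0∞) ^ 2 ≤ ∫⁻ t in Ioc (0:ℝ) 1, F x t := by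
    intro x
    have hc := continuous_lineDeriv hu x h
    have h1 := norm_sq_intervalIntegral_le hc
    have hi : IntegrableOn (fun t => ‖fderiv ℝ u (x + t • h) h‖ ^ 2) (Ioc (0:ℝ) 1) :=
      ((hc.norm.pow 2).integrableOn_Icc (a := 0) (b := 1)).mono_set Ioc_subset_Icc_self
    rw [sub_eq_integral_lineDeriv hu x h]
    calc (‖∫ t in (0:ℝ)..1, fderiv ℝ u (x + t • h) h‖₊ : ℝ≥0∞) ^ 2
        = ENNReal.ofReal (‖∫ t in (0:ℝ)..1, fderiv ℝ u (x + t • h) h‖ ^ 2) :=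
          (Poincare.ofReal_norm_sq _).symm
      _ ≤ ENNReal.ofReal (∫ t in (0:ℝ)..1, ‖fderiv ℝ u (x + t • h) h‖ ^ 2) :=
          ENNReal.ofReal_le_ofReal h1
      _ = ∫⁻ t in Ioc (0:ℝ) 1, F x t := by
          rw [intervalIntegral.integral_of_le zero_le_one,
            ofReal_integral_eq_lintegral_ofReal hi (ae_of_all _ fun _ => by positivity)]
          exact lintegral_congr fun t => Poincare.ofReal_norm_sq _
  -- measurability of the two-variable integrand
  have hFm : Measurable (Function.uncurry F) := by
    have hc : Continuous fun p : Space × ℝ => fderiv ℝ u (p.1 + p.2 • h) h :=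
      ((hu.continuous_fderiv one_ne_zero).comp
        (continuous_fst.add (continuous_snd.smul continuous_const))).clm_apply continuous_const
    exact (hc.measurable.nnnorm.coe_nnreal_ennreal).pow_const 2
  calc ∫⁻ x, (‖u (x + h) - u x‖₊ : ℝ≥0∞) ^ 2 ≤ ∫⁻ x, ∫⁻ t in Ioc (0:ℝ) 1, F x t :=
        lintegral_mono hpt
    _ = ∫⁻ t in Ioc (0:ℝ) 1, ∫⁻ x, F x t := lintegral_lintegral_swap hFm.aemeasurable
    _ = ∫⁻ t in Ioc (0:ℝ) 1, ∫⁻ x, (‖fderiv ℝ u x h‖₊ : ℝ≥0∞) ^ 2 := by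
        refine setLIntegral_congr_fun measurableSet_Ioc fun t _ => ?_
        exact lintegral_add_right_eq_self (fun x => (‖fderiv ℝ u x h‖₊ : ℝ≥0∞) ^ 2) (t • h)
    _ = ∫⁻ x, (‖fderiv ℝ u x h‖₊ : ℝ≥0∞) ^ 2 := by
        rw [setLIntegral_const, Real.volume_Ioc]; simp

/-- `single 0 s = s • e₀`, `e₀ = single 0 1` the first coordinate direction. [folklore] -/
theorem single_eq_smul_single_one (s : ℝ) :
    EuclideanSpace.single (0 : Fin 3) s = s • (EuclideanSpace.single (0 : Fin 3) (1 : ℝ) : Space) := by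
  ext j
  simp

/-- The slab `{x₁ < s}` is measurable. [folklore] -/
theorem measurableSet_slab (s : ℝ) : MeasurableSet {x : Space | x 0 < s} :=
  measurableSet_lt (PiLp.continuous_apply 2 (fun _ : Fin 3 => ℝ) 0).measurable measurable_const

/-- **Slab inequality**: a `C¹` function vanishing off the box `Λ_L` pays kinetic energy for its
mass within distance `s` of the face `{x₁ = 0}`: `∫_{x₁ < s} ‖u‖² ≤ s² ∫ ‖∂₁ u‖²`
(translate by `s e₁`: the translate vanishes on the slab). [folklore] -/
theorem slab_sq_le {L s : ℝ} {u : Space → ℂ} (hu : ContDiff ℝ 1 u)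
    (hu0 : ∀ x ∉ box L, u x = 0) :
    ∫⁻ x in {x : Space | x 0 < s}, (‖u x‖₊ : ℝ≥0∞) ^ 2 ≤
      ENNReal.ofReal (s ^ 2) * ∫⁻ x, (‖fderiv ℝ u x (EuclideanSpace.single (0 : Fin 3) (1 : ℝ) : Space)‖₊ : ℝ≥0∞) ^ 2 := by
  set h : Space := s • (EuclideanSpace.single (0 : Fin 3) (1 : ℝ) : Space) with hh
  have hvan : ∀ x : Space, x 0 < s → u (x - h) = 0 := by
    intro x hx
    refine hu0 _ fun hb => ?_
    have h0 := (hb 0).1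
    simp [hh] at h0
    linarith
  set G : Space → ℝ≥0∞ := fun y => (‖u (y + h) - u y‖₊ : ℝ≥0∞) ^ 2 with hG
  calc ∫⁻ x in {x : Space | x 0 < s}, (‖u x‖₊ : ℝ≥0∞) ^ 2
      = ∫⁻ x in {x : Space | x 0 < s}, G (x - h) := by
        refine setLIntegral_congr_fun (measurableSet_slab s) fun x hx => ?_
        simp only [hG, sub_add_cancel, hvan x hx, sub_zero]
    _ ≤ ∫⁻ x, G (x - h) := setLIntegral_le_lintegral _ _
    _ = ∫⁻ y, G y := lintegral_sub_right_eq_self G h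
    _ ≤ ∫⁻ y, (‖fderiv ℝ u y h‖₊ : ℝ≥0∞) ^ 2 := lintegral_translate_sub_sq_le hu h
    _ = ENNReal.ofReal (s ^ 2) * ∫⁻ y, (‖fderiv ℝ u y (EuclideanSpace.single (0 : Fin 3) (1 : ℝ) : Space)‖₊ : ℝ≥0∞) ^ 2 := by
        rw [← lintegral_const_mul' _ _ ENNReal.ofReal_ne_top]
        refine lintegral_congr fun y => ?_
        rw [hh, map_smul, nnnorm_smul, ENNReal.coe_mul, mul_pow, ← ENNReal.coe_pow,
          ← ENNReal.ofReal_coe_nnreal, NNReal.coe_pow, coe_nnnorm, Real.norm_eq_abs, sq_abs]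


/-! ## §2 The flat-mode overlap of a Dirichlet function is controlled by its kinetic energy -/

/-- A continuous function vanishing off the box is bounded. [folklore] -/
theorem exists_norm_le_of_box {L : ℝ} {u : Space → ℂ} (hu : Continuous u)
    (hu0 : ∀ x ∉ box L, u x = 0) : ∃ C, ∀ x, ‖u x‖ ≤ C := by
  have hsupp : HasCompactSupport u := by
    refine HasCompactSupport.intro (isCompact_closedBall (0 : Space) (3 * |L|)) fun x hx => ?_
    exact hu0 x fun hb => hx (mem_closedBall_zero_iff.2 (norm_le_of_mem_box hb))
  exact hu.bounded_above_of_compact_support hsupp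

/-- The part of the box within distance `s ≤ L` of the face `{x₁ = 0}` has volume `s L²`.
[folklore] -/
theorem volume_box_inter_slab {L s : ℝ} (hs : 0 ≤ s) (hsL : s ≤ L) :
    volume (box L ∩ {x : Space | x 0 < s}) = ENNReal.ofReal (s * L ^ 2) := by
  have hL : 0 ≤ L := hs.trans hsL
  set b : Fin 3 → ℝ := fun k => if k = 0 then s else L with hb
  have h : box L ∩ {x : Space | x 0 < s} =
      (@WithLp.ofLp 2 (Fin 3 → ℝ)) ⁻¹' (Set.univ.pi fun k => Set.Ioo 0 (b k)) := by
    ext x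
    simp only [box, Set.mem_inter_iff, Set.mem_setOf_eq, Set.mem_preimage, Set.mem_univ_pi,
      Set.mem_Ioo, hb]
    constructor
    · rintro ⟨h1, h2⟩ k
      by_cases hk : k = 0
      · subst hk; simpa using ⟨(h1 0).1, h2⟩
      · simpa [hk] using h1 k
    · intro h1
      refine ⟨fun k => ?_, by simpa using (h1 0).2⟩
      by_cases hk : k = 0
      · subst hk
        have := h1 0
        simp at this
        exact ⟨this.1, this.2.trans_le hsL⟩
      · simpa [hk] using h1 k
  rw [h, (PiLp.volume_preserving_ofLp (Fin 3)).measure_preimage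
    (MeasurableSet.univ_pi fun _ => measurableSet_Ioo).nullMeasurableSet, volume_pi_pi]
  simp only [Real.volume_Ioo, sub_zero, Fin.prod_univ_three, hb]
  simp only [Fin.ext_iff]
  norm_num
  rw [← ENNReal.ofReal_mul hs, ← ENNReal.ofReal_mul (by positivity)]
  ring_nf

/-- `ENNReal` bookkeeping for the flat-overlap bound. [folklore] -/
theorem flat_aux {L s : ℝ} (hL : 0 < L) (hs : 0 ≤ s) {a W : ℝ≥0∞}
    (h : ENNReal.ofReal (s * L ^ 2 + 2 * L ^ 3) * a ≤ 2 * W) :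
    ENNReal.ofReal (L ^ 3) * a ≤ ENNReal.ofReal (2 * L / (2 * L + s)) * W := by
  have hpos : 0 < 2 * L + s := by positivity
  have hid : ENNReal.ofReal (L ^ 3) =
      ENNReal.ofReal (L / (2 * L + s)) * ENNReal.ofReal (s * L ^ 2 + 2 * L ^ 3) := by
    rw [← ENNReal.ofReal_mul (by positivity)]
    congr 1
    field_simp
    ring
  calc ENNReal.ofReal (L ^ 3) * a
      = ENNReal.ofReal (L / (2 * L + s)) * (ENNReal.ofReal (s * L ^ 2 + 2 * L ^ 3) * a) := by
        rw [hid, mul_assoc]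
    _ ≤ ENNReal.ofReal (L / (2 * L + s)) * (2 * W) := by gcongr
    _ = ENNReal.ofReal (2 * L / (2 * L + s)) * W := by
        rw [← mul_assoc, mul_comm _ (2 : ℝ≥0∞), ← ENNReal.ofReal_ofNat 2,
          ← ENNReal.ofReal_mul (by norm_num)]
        congr 2
        ring

/-- **Flat overlap versus kinetic energy (one body).** For a `C¹` function `u` vanishing off the
box `Λ_L` and `0 < s ≤ L`:
`|⟨φ_L, u⟩|² = L⁻³|∫_Λ u|² ≤ (2L/(2L+s)) (‖u‖² + s² ‖∂₁u‖²)` (`φ_L = L^{-3/2}1_Λ` the flat mode).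
Proof: with `m` the mean of `u` over the box, `|⟨φ_L,u⟩|² = L³|m|²`; on the slab
`A = Λ_L ∩ {x₁ < s}` (volume `sL²`), `|m|² ≤ 2|u − m|² + 2|u|²`, so
`sL²|m|² ≤ 2∫_Λ|u − m|² + 2∫_A|u|² = 2(∫_Λ|u|² − L³|m|²) + 2∫_A|u|²`, and `∫_A |u|² ≤ s²∫|∂₁u|²`
(`slab_sq_le`). In words: a Dirichlet function cannot be flat up to the wall for free.
[folklore] -/
theorem flatOverlap_sq_le {L s : ℝ} (hL : 0 < L) (hs : 0 < s) (hsL : s ≤ L) {u : Space → ℂ}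
    (hu : ContDiff ℝ 1 u) (hu0 : ∀ x ∉ box L, u x = 0) :
    (ENNReal.ofReal L ^ 3)⁻¹ * (‖∫ x in box L, u x‖₊ : ℝ≥0∞) ^ 2 ≤
      ENNReal.ofReal (2 * L / (2 * L + s)) *
        ((∫⁻ x, (‖u x‖₊ : ℝ≥0∞) ^ 2) +
          ENNReal.ofReal (s ^ 2) * ∫⁻ x, (‖fderiv ℝ u x (EuclideanSpace.single (0 : Fin 3) (1 : ℝ) : Space)‖₊ : ℝ≥0∞) ^ 2) := by
  set μ : Measure Space := volume.restrict (box L) with hμ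
  set m : ℂ := ⨍ x, u x ∂μ with hm
  obtain ⟨C, hC⟩ := exists_norm_le_of_box hu.continuous hu0
  have hL3 : 0 < L ^ 3 := by positivity
  have hvol : volume (box L) = ENNReal.ofReal (L ^ 3) := by
    rw [volume_box, ENNReal.ofReal_pow hL.le]
  have hreal : μ.real univ = L ^ 3 := by
    rw [measureReal_def, hμ, Measure.restrict_apply_univ, hvol, ENNReal.toReal_ofReal hL3.le]
  have hmeas : AEStronglyMeasurable u μ := hu.continuous.aestronglyMeasurable
  -- (E1) the variance identity, in `ℝ≥0∞`
  have hvarR := Poincare.integral_norm_sub_sq_eq (μ := μ) hmeas hC (0 : ℂ)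
  simp only [sub_zero] at hvarR
  rw [hreal] at hvarR
  have hi1 : Integrable (fun x => ‖u x‖ ^ 2) μ := by
    refine Poincare.integrable_of_norm_le (hmeas.norm.pow 2) (C := C ^ 2) fun x => ?_
    rw [norm_pow, norm_norm]
    exact pow_le_pow_left₀ (norm_nonneg _) (hC x) 2
  have hi2 : Integrable (fun x => ‖u x - m‖ ^ 2) μ := by
    refine Poincare.integrable_of_norm_le ((hmeas.sub aestronglyMeasurable_const).norm.pow 2)
      (C := (C + ‖m‖) ^ 2) fun x => ?_
    rw [norm_pow, norm_norm]
    exact pow_le_pow_left₀ (norm_nonneg _) ((norm_sub_le _ _).trans (by gcongr; exact hC x)) 2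
  have hE1 : ∫⁻ x in box L, (‖u x‖₊ : ℝ≥0∞) ^ 2 =
      (∫⁻ x in box L, (‖u x - m‖₊ : ℝ≥0∞) ^ 2) + ENNReal.ofReal (L ^ 3) * (‖m‖₊ : ℝ≥0∞) ^ 2 := by
    have e1 : ∫⁻ x in box L, (‖u x‖₊ : ℝ≥0∞) ^ 2 = ENNReal.ofReal (∫ x, ‖u x‖ ^ 2 ∂μ) := by
      rw [ofReal_integral_eq_lintegral_ofReal hi1 (ae_of_all _ fun _ => by positivity)]
      exact lintegral_congr fun x => (Poincare.ofReal_norm_sq _).symm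
    have e2 : ∫⁻ x in box L, (‖u x - m‖₊ : ℝ≥0∞) ^ 2 = ENNReal.ofReal (∫ x, ‖u x - m‖ ^ 2 ∂μ) := by
      rw [ofReal_integral_eq_lintegral_ofReal hi2 (ae_of_all _ fun _ => by positivity)]
      exact lintegral_congr fun x => (Poincare.ofReal_norm_sq _).symm
    rw [e1, e2, hvarR, ENNReal.ofReal_add (integral_nonneg fun _ => by positivity) (by positivity),
      ENNReal.ofReal_mul hL3.le, Poincare.ofReal_norm_sq]
  -- (E2) the slab estimate for the mean
  set A : Set Space := box L ∩ {x : Space | x 0 < s} with hA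
  have hAm : MeasurableSet A := (measurableSet_box L).inter (measurableSet_slab s)
  have hE2 : volume A * (‖m‖₊ : ℝ≥0∞) ^ 2 ≤
      2 * (∫⁻ x in box L, (‖u x - m‖₊ : ℝ≥0∞) ^ 2) +
        2 * (ENNReal.ofReal (s ^ 2) * ∫⁻ x, (‖fderiv ℝ u x (EuclideanSpace.single (0 : Fin 3) (1 : ℝ) : Space)‖₊ : ℝ≥0∞) ^ 2) := by
    have hf1 : Measurable fun x => (‖u x - m‖₊ : ℝ≥0∞) ^ 2 :=
      ((hu.continuous.sub continuous_const).measurable.nnnorm.coe_nnreal_ennreal).pow_const 2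
    calc volume A * (‖m‖₊ : ℝ≥0∞) ^ 2 = ∫⁻ _ in A, (‖m‖₊ : ℝ≥0∞) ^ 2 := by
          rw [setLIntegral_const, mul_comm]
      _ ≤ ∫⁻ x in A, (2 * (‖u x - m‖₊ : ℝ≥0∞) ^ 2 + 2 * (‖u x‖₊ : ℝ≥0∞) ^ 2) := by
          refine lintegral_mono fun x => ?_
          have h2 : (‖m - u x‖₊ : ℝ≥0∞) = ‖u x - m‖₊ := by rw [← nnnorm_neg, neg_sub]
          have := ennnorm_sq_le_two_mul m (u x)
          rwa [h2] at this
      _ = 2 * (∫⁻ x in A, (‖u x - m‖₊ : ℝ≥0∞) ^ 2) + 2 * ∫⁻ x in A, (‖u x‖₊ : ℝ≥0∞) ^ 2 := by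
          rw [lintegral_add_left (hf1.const_mul _), lintegral_const_mul _ hf1,
            lintegral_const_mul _ ((hu.continuous.measurable.nnnorm.coe_nnreal_ennreal).pow_const 2)]
      _ ≤ 2 * (∫⁻ x in box L, (‖u x - m‖₊ : ℝ≥0∞) ^ 2) +
            2 * ∫⁻ x in {x : Space | x 0 < s}, (‖u x‖₊ : ℝ≥0∞) ^ 2 := by
          gcongr
          · exact Set.inter_subset_left
          · exact Set.inter_subset_right
      _ ≤ _ := by
          gcongr
          exact slab_sq_le hu hu0
  -- combine (E1) and (E2)
  have hvolA : volume A = ENNReal.ofReal (s * L ^ 2) := volume_box_inter_slab hs.le hsL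
  set T₁ := ∫⁻ x, (‖fderiv ℝ u x (EuclideanSpace.single (0 : Fin 3) (1 : ℝ) : Space)‖₊ : ℝ≥0∞) ^ 2 with hT₁
  set W := (∫⁻ x, (‖u x‖₊ : ℝ≥0∞) ^ 2) + ENNReal.ofReal (s ^ 2) * T₁ with hW
  have hstar : ENNReal.ofReal (s * L ^ 2 + 2 * L ^ 3) * (‖m‖₊ : ℝ≥0∞) ^ 2 ≤ 2 * W := by
    have hbox_le : ∫⁻ x in box L, (‖u x‖₊ : ℝ≥0∞) ^ 2 ≤ ∫⁻ x, (‖u x‖₊ : ℝ≥0∞) ^ 2 :=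
      setLIntegral_le_lintegral _ _
    calc ENNReal.ofReal (s * L ^ 2 + 2 * L ^ 3) * (‖m‖₊ : ℝ≥0∞) ^ 2
        = volume A * (‖m‖₊ : ℝ≥0∞) ^ 2 + 2 * (ENNReal.ofReal (L ^ 3) * (‖m‖₊ : ℝ≥0∞) ^ 2) := by
          rw [hvolA, ENNReal.ofReal_add (by positivity) (by positivity), add_mul, ← mul_assoc,
            ← ENNReal.ofReal_ofNat 2, ← ENNReal.ofReal_mul (by norm_num)]
      _ ≤ 2 * (∫⁻ x in box L, (‖u x - m‖₊ : ℝ≥0∞) ^ 2) + 2 * (ENNReal.ofReal (s ^ 2) * T₁) +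
            2 * (ENNReal.ofReal (L ^ 3) * (‖m‖₊ : ℝ≥0∞) ^ 2) := by gcongr
      _ = 2 * (∫⁻ x in box L, (‖u x‖₊ : ℝ≥0∞) ^ 2) + 2 * (ENNReal.ofReal (s ^ 2) * T₁) := by
          rw [hE1]; ring
      _ ≤ 2 * W := by
          rw [hW, mul_add]
          gcongr
  -- the overlap is `L³ |m|²`
  have hov : (ENNReal.ofReal L ^ 3)⁻¹ * (‖∫ x in box L, u x‖₊ : ℝ≥0∞) ^ 2 =
      ENNReal.ofReal (L ^ 3) * (‖m‖₊ : ℝ≥0∞) ^ 2 := by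
    have hint : ∫ x in box L, u x = ((L ^ 3 : ℝ) : ℂ) * m := by
      have h1 := measure_smul_average (μ := μ) u
      rw [hreal, Complex.real_smul] at h1
      exact h1.symm
    rw [hint, nnnorm_mul, ENNReal.coe_mul, mul_pow, ← mul_assoc, ← ENNReal.ofReal_pow hL.le]
    congr 1
    rw [← ENNReal.coe_pow, ← ENNReal.ofReal_coe_nnreal, NNReal.coe_pow, coe_nnnorm,
      Complex.norm_real, Real.norm_of_nonneg hL3.le, ← ENNReal.ofReal_inv_of_pos hL3,
      ← ENNReal.ofReal_mul (by positivity)]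
    congr 1
    field_simp
  rw [hov]
  exact flat_aux hL hs.le hstar

end Summit.AtomisticToContinuum.BoseEinsteinCondensation.Theorems.PeriodicToDirichlet.Negative

end
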